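import Mathlib.Tactic.Linarith
import Mathlib.Tactic.Ring
import Mathlib.Tactic.NormNum
import HarnessLib

/-!
# The (0,1) cell of the ι-window, EXISTENCE side, XIX (continued): arithmetic skeleton of `H2-EXISTENCE-SIDE-19.md` §9 ff.

Family `hodge`, b2b cell `hweil`, `Summits/HodgeConjecture/HodgeConjecture/Theorems` (helper of item stmt-HodgeConjecture-2524). Continuation of
`WeilTypeLadderH2UniformPlane.lean` (which reached the 400-line cap with its ADDENDA A–C): the def-free shadows of [XIX] ADDENDUM D and later.
Setting and notation as there: `(A, Θ)` a general ppav fourfold, `Z` an ι-invariant Abel–Prym carrier, `a ∈ A° ∖ V_Z`, `S_a = Θ_a ∩ Θ_{−a}`,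
`Λ_a = H⁰(𝓘_{S_a}(2Θ))`, the hulls `𝓛₁ = 𝓘^∨(Θ)`, `𝓛₂ = 𝓘(2Θ)` (`𝓘 = 𝓘_{S_a/D}`), the local invariants `e_z`, `c_z` of [XIX] §8. HONEST FRAMING: census
results about one cell of the ladder's H2 test on the existence side; no case of the Hodge conjecture is proved; nothing here is a rung; no
statement of [Markman 2025] is used. 0 unconditional rungs above the floor.
-/

set_option linter.dupNamespace false

namespace Summit.HodgeConjecture.HodgeConjecture.WeilTypeLadder

section H2UniformPlaneAddendumD

/-!
## ADDENDUM D (report §9): (b-iii) is VOID (the only non-integral member of ℙ(Λ_a) is Θ_a + Θ_{−a}); effectivity is AUTOMATIC (h⁰(𝓘^∨_{S_a/D}) = 1,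
## so (R16-f) is struck as an exception); junk at non-nodal singular points: colength one is a limit of free-point junk, colength two off S_a
## moves in Hilb² = ℙ³ — (b-ii) reduced to the corner (b-ii)′

LEMMA V (9.1): for `a ∉ A[2]` on any ppav fourfold, `H⁰(𝓘_{S_a}(Θ_b)) = 0` unless `b = ±a` (Koszul: `h⁰(𝒪(Θ_b − Θ_{±a})) = 0` for a non-trivial
point of `Pic⁰`, `H¹(𝒪(−Θ) ⊗ P) = 0`), while `h⁰(𝓘_{S_a}(2Θ)) = 1 + 1 − 1 + h¹(𝒪_A) = 5`; so the theta translates containing `S_a` are exactly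
`Θ_{±a}`, the only non-integral member of `ℙ(Λ_a)` (for `NS = ℤθ`) is `Θ_a + Θ_{−a}`, and it contains the carrier only if `a ∈ V_Z`: the sub-row
(b-iii) is VOID. LEMMA EFF (9.2): `h⁰(D, 𝓘^∨_{S_a/D}) = 1` for every member (`𝓘^∨ ↪ 𝒪_D(Θ_a|_D)`, `h⁰(𝒪_D(Θ_a)) = 1 + h¹(𝒪_A(−Θ)·) = 1`), and an
isomorphism `𝓘^∨_{S_{a′}} ≅ 𝓘^∨_{S_{a″}}` transports the unique sections, whose duals are the inclusions — so `𝓘_{S_{a′}} = 𝓘_{S_{a″}}` and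
`a″ = ±a′`: the classifying maps of all families of §§3, 7, 8 are quasi-finite WITHOUT any finiteness clause on theta-intersections, and
THEOREM H / COR G / THM D⁺ hold with no '(R16-f)′' exception. PROPOSITION J (9.3): junk of colength one at a singular point is a flat limit
of free-point junk (the projectivisation of an MF module `coker(φ : P^n → P^n)` is cut by `n` equations in `ℙ^{n−1} × A`, so has no
component over a singular locus of dimension `≤ 1`); junk of colength two at a singular point off `S_a ∪ Z` moves in `Hilb²(D, x) = ℙ³`;
with the H2 equations, junk of total length `4` at non-nodal singular points forces an intersection orbit with `e ≥ 2` on the carrier. The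
residual of the 2Θ-habitat on a general `A`: (b-ii)′ (that corner), (R16-d), nest (N16-M); (R16-c) special `A`.
-/

/-- LEMMA V (report 9.1), the cohomological bookkeeping: from `0 → 𝒪(L − Θ_a − Θ_{−a}) → 𝒪(L − Θ_a) ⊕ 𝒪(L − Θ_{−a}) → 𝓘_{S_a}(L) → 0` one gets
`h⁰(𝓘_{S_a}(L)) = h⁰(L − Θ_a) + h⁰(L − Θ_{−a}) − h⁰(L − Θ_a − Θ_{−a}) + (dimension of the kernel of H¹(L − Θ_a − Θ_{−a}) → H¹(L − Θ_a) ⊕ H¹(L − Θ_{−a}))`.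
For `L = 2Θ`: `L − Θ_{±a} ≅ 𝒪(Θ_{∓a})` (`h⁰ = 1`, `h¹ = 0`), `L − Θ_a − Θ_{−a} ≅ 𝒪_A` (`h⁰ = 1`, `h¹ = 4`): `h⁰(Λ_a) = 1 + 1 − 1 + 4 = 5` ([XVI] 1.1).
For `L = Θ_b`, `b ≠ ±a`: `L − Θ_{±a}` are NON-trivial points of `Pic⁰` (`h⁰ = 0`) and `L − Θ_a − Θ_{−a} ≡ −Θ` (`h⁰ = h¹ = 0`, Mumford vanishing):
`h⁰(𝓘_{S_a}(Θ_b)) = 0` — no theta translate other than `Θ_{±a}` contains `S_a`. Recorded: the two sums. -/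
theorem theta_translates_through_Sa_count :
    (1 : ℤ) + 1 - 1 + 4 = 5 ∧ (0 : ℤ) + 0 - 0 + 0 = 0 := by
  norm_num

/-- PROPOSITION J (report 9.3), the junk bookkeeping at non-nodal singular points. Junk of an `ι`-sheaf at non-fixed points comes in `ι`-pairs of
equal length, total `ℓ ∈ {2, 4}`; with the H2 equations of 8.1 (first hull `n_S − c + ℓ = 4`, second hull `n_S = 4 + ℓ`, `n_S ≤ 6`, `c` a sum
over at most `k − 1` singular orbits of `2c_z`, `c_z ≥ 1`): `ℓ = 4` is impossible for the second hull and forces `n_S = c ∈ {4, 6}` for the first,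
i.e. an intersection orbit on the carrier with `c_z ≥ 2` (hence `e_z ≥ 2`) — since `k = n_S/2` orbits cannot all be singular (`j ≤ k − 1`).
The dimension inputs: `Hilb²(D, x) = ℙ((𝔪_x/𝔪_x²)^∨) = ℙ³` at every singular point of a hypersurface in the fourfold (embedding dimension `4`, and
`f ∈ 𝔪²` lies in every ideal containing `𝔪²`), of dimension `3 ≥ 2`; and `ℙ(coker φ)` for an `n × n` matrix factorisation is cut by `n`
equations in `ℙ^{n−1} × A`, so its components have dimension `≥ (n − 1) + 4 − n = 3` while a fibre `ℙ^{≤ n−1}` over a singular locus of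
dimension `s ≤ 1` spans only `≤ s + n − 1 ≤ n < 3` for `n = 2` (the hulls) — no component hides there. Recorded: the arithmetic. -/
theorem junk_at_bad_points_census (nS c ℓ : ℕ) (hS : nS = 0 ∨ nS = 2 ∨ nS = 4 ∨ nS = 6) (hℓ : ℓ = 4) :
    (nS ≠ 4 + ℓ) ∧ (nS + ℓ = 4 + c → c = nS) ∧
    ((4 : ℤ) - 1 = 3 ∧ (2 : ℤ) ≤ 3 ∧ (2 - 1 : ℤ) + 4 - 2 = 3 ∧ (1 : ℤ) + 2 - 1 < 3) := by
  subst hℓ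
  refine ⟨by omega, by omega, by norm_num⟩

end H2UniformPlaneAddendumD

section H2UniformPlaneAddendumE

/-!
## ADDENDUM E (report §10): colength-two junk at a non-nodal singular point is never rigid — the punctual Quot² of the matrix-factorisation
## module and of 𝓘_{Z/D} through the tangent cone; the corner (b-ii)′ shrinks to (2,2)-junk AT a degenerate intersection orbit

PROPOSITION J (e) (10.1): at a non-nodal singular point `x ∈ S_a` the hull stalk `M = coker Φ̄` (`Φ` the `2 × 2` MF matrix, entries in `𝔪`) has
`M ⊗ 𝒪_{ξ_τ} = k[ε]²/ε·Im(∂_τΦ)` for the length-two subscheme `ξ_τ` in direction `τ`, so cyclic colength-two quotients `M ↠ 𝒪_{ξ_τ}` exist iff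
`rank ∂_τΦ(x) ≤ 1` iff `q_f(τ) = 0` (`det ∂_τΦ` is the quadratic part of `f = ug + vh`): `τ` on the tangent cone, a surface in `ℙ(T_xA) = ℙ³`; for
each such `τ` the kernels form an irreducible family of dimension `2 − rank ≥ 1`; the non-cyclic submodule `𝔪M` lies on the projective space
`ℙ(K₁ ⊗ k)` of colength-one submodules of any colength-one `K₁ ⊃ 𝔪M`, of dimension `μ(K₁) − 1 ≥ 2` (`μ(K₁) ≥ 1 + (4 − 2)`: only `s ∈ (u, h) + 𝔪²`
can move `s·e₂` into `𝔪e₁ + 𝔪²M`). So EVERY colength-two submodule of `M` lies on an irreducible projective family of such of dimension `≥ 2`: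
(2,2)-junk at `±x` is DEAD by the family mechanism — a punctual statement, no hypothesis on `Sing D`. PROPOSITION J (f) (10.2): the same at a
singular point `x ∈ Z ∖ S_a` for `𝓘_{Z/D,x}` (three generators; non-cyclic submodules: a `ℙ²`; cyclic: `τ` on the cone or `τ = T_xZ`, kernels
`≥ 2`-dimensional). COROLLARY (10.3): with [XIX] 9.3 (c) the corner (b-ii)′ is (d1)″ '(2,2)-junk at a DEGENERATE INTERSECTION ORBIT on the carrier
with `μ(N) = 2`, in an `ℓ = 4` configuration (which needs an orbit with `e ≥ 2`)' ∪ (d2) 'colength-one junk at a point where `Sing D` is a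
surface, or on `Z` with `D` singular along `Z`' — and (d2)'s second clause is VOID when all orbits of `Z ∩ S_a` are reduced (no member through `Z` is
singular at all `k` orbits: `ℙ^{k−k−1} = ∅`), (d2)'s first clause dies by moving the junk point in the singular surface.
-/

/-- PROPOSITION J (e)(f) (report 10.1–10.2), the dimension bookkeeping of the punctual Quot²: cyclic quotients over the tangent cone (a surface,
dimension `2`, in `ℙ³`) with kernel families of dimension `2 − r` (`r = rank ∂_τΦ ∈ {0, 1}`): `2 + (2 − 1) = 3 ≥ 2` and `0 + (2 − 0) = 2 ≥ 2`; the
non-cyclic point `𝔪M` on `ℙ^{μ(K₁) − 1}` with `μ(K₁) ≥ 1 + (4 − 2) = 3`; for `𝓘_{Z/D,x}` (three generators): non-cyclic submodules `ℙ²` (dimension `2`),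
cyclic kernels of dimension `(2(3 − d) + d) − 2 = 4 − d ≥ 2` for `d ≤ 2`. Recorded: the arithmetic. -/
theorem quot_two_family_dims (d : ℕ) (hd : d ≤ 2) :
    (2 : ℤ) + (2 - 1) = 3 ∧ (0 : ℤ) + (2 - 0) = 2 ∧ (3 : ℤ) ≤ 1 + (4 - 2) ∧ (2 : ℤ) ≤ (1 + (4 - 2)) - 1 ∧ (3 : ℤ) - 1 = 2 ∧
    2 ≤ (2 * (3 - d) + d) - 2 := by
  refine ⟨by norm_num, by norm_num, by norm_num, by norm_num, by norm_num, by omega⟩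

/-- COROLLARY (report 10.3), members singular at ALL intersection orbits: by the uniform plane lemma the members of `ℙ(Λ_a)` through `Z` singular
at `j` distinct orbits form `ℙ^{k−j−1}`; with `r` distinct orbits in total (`Σ μ_p = k`, so `r ≤ k`, and `r = k` iff every orbit is reduced),
'singular at all orbits' is `ℙ^{k−r−1}` — EMPTY iff `r = k`. So a member through a carrier with reduced intersection is never singular at every
point of `Z ∩ S_a`, in particular never singular along `Z`. Recorded: `k − r − 1 < 0 ↔ r = k` for `r ≤ k`. -/
theorem no_member_singular_at_all_reduced_orbits (k r : ℕ) (hr : r ≤ k) :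
    ((k : ℤ) - r - 1 < 0 ↔ r = k) ∧ (r < k → 0 ≤ (k : ℤ) - r - 1) := by
  constructor <;> [constructor; skip] <;> intros <;> omega

end H2UniformPlaneAddendumE

section H2CarrierJunkXX

/-!
## [XX] (report `H2-EXISTENCE-SIDE-20.md`, prover 3 gen 27): junk on the carrier is never rigid (THEOREM K); the cell (d1)⁺ ∪ (d2)′ of
## O-P3g26-1 is DEAD; the complete type table F1–F9 / S1–S2 of the normal form; Grothendieck–Lefschetz for members of |2Θ| (LEMMA GL)

SHAPE LEMMA (report §2): at `z ∈ Z ∩ S_a` on ANY member `D = {f = ug + vh = 0}` the junk-free stalk of either hull is `N = (I ∩ J)/(f)` with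
`I = (u, v)` resp. `(u, h)` and `J = 𝓘_Z`; `I ∩ J = (ω) + θ₁J` for `ω := θ₂ − cθ₁ ∈ J`; case (α) `dω(z) ≠ 0`: `μ_P(I ∩ J) = 1 + 2 = 3`, `μ(N) = 3 − ε`
(`ε = 1` iff `f` is a minimal generator of `I ∩ J`); case (β) `dω(z) = 0`: `μ_P(I ∩ J) = 4`, `μ(N) ≥ 3`; the second hull is always in case (α);
`D` singular along `Z` forces `f ∈ J·(I ∩ J)`, so `μ(N) = 3`; FIRST-ORDER FREENESS: if `μ(N) = 2` then every relation `r₀ω̄ + r₁n̄ = 0` has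
`r₀ ∈ 𝔪²`, so `N/J_τN ≅ k[ε]ω̄ ⊕ (k[ε] or k)n̄` — cyclic colength-two quotients exist in EVERY direction `τ`. THEOREM K (§3): at a non-fixed
carrier point `w` with `μ := μ(F̂_w)`, colength-one junk lies on `ℙ^{μ−1}` (dimension `μ − 1 ≥ 2` iff `μ ≥ 3`) or, for `μ = 2`, on the
`1 + 1 = 2`-dimensional TRANSPORT family along `Z` (`F̂ ⊗ 𝒪_Z` locally free of rank `2` near `w`); colength-two junk lies on the Grassmannian
(dimension `2(μ − 2) ≥ 2`) or a cosocle-type family (dimension `a + μ − 2 ≥ 2`, `a ≥ 1`) when `μ ≥ 3`, and for `μ = 2` on the closure of the cyclic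
family `Σ_U ≅ U × 𝔸¹` (dimension `3 + 1 = 4`), which contains the unique non-cyclic submodule `𝔪F̂_w = lim K(τ, γ)`; per direction the
cyclic kernels form a family of dimension `2a + (2 − a) − 2 = a`. Hence `e₁^ι ≥ 2` for every configuration with junk on the carrier, on every
member: (d1)⁺, (d2)′ and the missing cell F7 = (6; c_z = 2; ℓ = 2) of O-P3g26-1 are DEAD; (b-ii) is closed; (R16-b) is DEAD with no residual.
PROPOSITION T (§4): the H2-numerical types of the normal form (first hull `n_S − c + ℓ = 4`, second hull `n_S = 4 + ℓ`, `n_S ∈ {2, 4, 6}`, `ℓ ∈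
{0, 2, 4}`, `c ≤ n_S` even) have signatures `(n_S, c, ℓ) ∈ {(2,0,2), (4,0,0), (4,2,2), (4,4,4), (6,2,0), (6,4,2), (6,6,4)}` resp. `(4,·,0), (6,·,2)`;
with the c-vector refinement these are F1–F9 and S1–S2, every one DEAD (THEOREM H junk-free; NF / THMS 1–3 / PROP J / THEOREM K with junk):
the normal-form 2Θ-habitat contains no H2 object on a general fourfold [étale carriers thm; nodal carriers thm given (F1)–(F2)]. LEMMA GL (§5):
for every member `D ∈ |2Θ|` of an abelian FOURFOLD, `Pic A → Pic D` is an isomorphism (Hartshorne, Ample Subvarieties IV 1.5 + 3.1: Leff from the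
very ample `4Θ`, and `H^i(D, 𝒪_D(−nD)) = 0` for `i = 1, 2` from Mumford vanishing on `A` in degrees `i, i + 1 ≤ 3 < 4`); so the nest (N16-M) is part
of the normal form (twist by a point of `Pic⁰(A)[2]`) or of (R16-d), and is struck as a separate row. Residual of [XVI]'s habitat on a general
`A`: (R16-d) (exotic reflexive hulls — the defect of special members), the scoping clause (R16-g) (`a ∉ A°`); (R16-c) special `A`. (0,1) NOT
decided; no H2 object; 0 rungs.
-/

/-- SHAPE LEMMA (report 2.2), the generator bookkeeping: in case (α) the ideal `I ∩ J = (ω, θ₁b₁, θ₁b₂)` has `1 + 2 = 3` minimal generators and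
`μ(N) = 3 − ε ∈ {2, 3}` (`ε ≤ 1` records whether `f` is a minimal generator); in case (β) `μ_P(I ∩ J) = 4` and `μ(N) = 4 − ε ≥ 3`; the colength-one
junk at the point moves in `ℙ^{μ−1}`, of dimension `≥ 2` exactly when `μ ≥ 3`, and for `μ = 2` the transport family along the carrier has dimension
`1 + 1 = 2` (a `ℙ¹`-bundle over the curve). Recorded: the arithmetic. -/
theorem shape_lemma_mu_dichotomy (ε μ : ℕ) (hε : ε ≤ 1) (hμ : 2 ≤ μ) :
    (1 : ℕ) + 2 = 3 ∧ (3 - ε = 2 ∨ 3 - ε = 3) ∧ 3 ≤ 4 - ε ∧ (2 ≤ μ - 1 ↔ 3 ≤ μ) ∧ (1 : ℕ) + 1 = 2 := by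
  refine ⟨by norm_num, by omega, by omega, by omega, by norm_num⟩

/-- THEOREM K (b) (report 3.1), the colength-two family dimensions: for `μ ≥ 3` the non-cyclic submodules form the Grassmannian of codimension-two
subspaces of `M ⊗ k`, of dimension `2(μ − 2) ≥ 2`, and the cyclic kernels of a fixed cosocle type `τ` (with `M/J_τM ≅ k[ε]^a ⊕ k^b`, `a + b = μ`,
`a ≥ 1`) form a family of dimension `(2a + b) − 2 = a + μ − 2 ≥ 2` (surjections onto `k[ε]` modulo `k[ε]^×`); for `μ = 2` the per-direction
dimension is `2a + (2 − a) − 2 = a ∈ {1, 2}` and over the open set `U ⊂ ℙ³` of directions with `a = 1` the total family has dimension `3 + 1 = 4`.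
Recorded: the arithmetic. -/
theorem colength_two_family_dims (μ a b : ℕ) (hab : a + b = μ) (ha : 1 ≤ a) :
    (3 ≤ μ → 2 ≤ 2 * (μ - 2) ∧ 2 ≤ (2 * a + b) - 2 ∧ (2 * a + b) - 2 = a + μ - 2) ∧
    (μ = 2 → (2 * a + b) - 2 = a ∧ (a = 1 ∨ a = 2)) ∧ (3 : ℕ) + 1 = 4 := by
  refine ⟨fun h => ⟨by omega, by omega, by omega⟩, fun h => ⟨by omega, by omega⟩, by norm_num⟩

/-- O-P3g26-1's cell (report 1.1, 4.2): with junk of length `ℓ = 2` the first-hull equation `n_S − c + ℓ = 4` (`n_S ∈ {0, 2, 4, 6}`) has exactly the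
solutions `(n_S, c) ∈ {(2, 0), (4, 2), (6, 4)}`, and `c = 4` is realised either by two singular orbits with `c_z = 1` each (`2·1 + 2·1`, type F6 =
FH(3,2,2)) or by ONE singular orbit with `c_z = 2` (`2·2`, type F7 — the cell missing from [XIX] 9.3's lists, dead by THEOREM K). Recorded: the
arithmetic. -/
theorem first_hull_ell_two_types (nS c : ℕ) (hS : nS = 0 ∨ nS = 2 ∨ nS = 4 ∨ nS = 6) (h : nS + 2 = 4 + c) :
    ((nS = 2 ∧ c = 0) ∨ (nS = 4 ∧ c = 2) ∨ (nS = 6 ∧ c = 4)) ∧ (4 : ℕ) = 2 * 1 + 2 * 1 ∧ (4 : ℕ) = 2 * 2 := by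
  refine ⟨by omega, by norm_num, by norm_num⟩

/-- PROPOSITION T (report §4), the signature enumeration: under the constraints of 4.1 (`n_S ∈ {2, 4, 6}` — `n_S = 0` carries no member through
the carrier —, `ℓ ∈ {0, 2, 4}`, `c` even with `c ≤ n_S`, and `c > 0` only if `n_S ≥ 4` — a singular orbit needs `j ≤ k − 1`, i.e. `k ≥ 2`; without
this clause `(n_S, c, ℓ) = (2, 2, 4)` would be a spurious solution) the first-hull equation `n_S + ℓ = 4 + c` has exactly the seven numerical
signatures `(n_S, c, ℓ) = (2,0,2), (4,0,0), (4,2,2), (4,4,4), (6,2,0), (6,4,2), (6,6,4)` (refined by the c-vector into F1–F9: `c = 4` as `(1,1)` or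
`(2)`, `c = 6` as `(2,1)` or `(3)`), and the second-hull equation `n_S = 4 + ℓ` exactly `(4, ·, 0)` and `(6, ·, 2)`. Recorded: the enumeration. -/
theorem normal_form_type_signatures (nS ℓ c : ℕ) (hS : nS = 2 ∨ nS = 4 ∨ nS = 6) (hℓ : ℓ = 0 ∨ ℓ = 2 ∨ ℓ = 4)
    (hc : c ≤ nS) (h2 : 2 ∣ c) (hj : 0 < c → 4 ≤ nS) :
    (nS + ℓ = 4 + c →
      (nS = 2 ∧ c = 0 ∧ ℓ = 2) ∨ (nS = 4 ∧ c = 0 ∧ ℓ = 0) ∨ (nS = 4 ∧ c = 2 ∧ ℓ = 2) ∨ (nS = 4 ∧ c = 4 ∧ ℓ = 4) ∨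
      (nS = 6 ∧ c = 2 ∧ ℓ = 0) ∨ (nS = 6 ∧ c = 4 ∧ ℓ = 2) ∨ (nS = 6 ∧ c = 6 ∧ ℓ = 4)) ∧
    (nS = 4 + ℓ → (nS = 4 ∧ ℓ = 0) ∨ (nS = 6 ∧ ℓ = 2)) := by
  have hc' : ∀ {ℓ'}, nS + ℓ' = 4 + c → c = nS + ℓ' - 4 := fun h => by omega
  constructor
  · intro h
    obtain rfl := hc' h
    rcases hS with rfl | rfl | rfl <;> rcases hℓ with rfl | rfl | rfl <;> simp at h hj ⊢
  · intro h
    omega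

/-- LEMMA GL (report 5.1), the cohomological degrees: Hartshorne's Theorem IV 3.1 needs `H^i(D, 𝒪_D(−nD)) = 0` for `i ∈ {1, 2}`, and the exact
sequence `0 → 𝒪_A(−(n+1)D) → 𝒪_A(−nD) → 𝒪_D(−nD) → 0` places that group between `H^i(A, 𝒪_A(−nD))` and `H^{i+1}(A, 𝒪_A(−(n+1)D))`, which vanish
by Mumford's theorem in all degrees `< dim A = 4`: the degrees used are `i` and `i + 1` with `i + 1 ≤ 3 < 4` — a FOURFOLD phenomenon (for a
threefold the degree `i + 1 = 3 = dim` is not covered). Recorded: the arithmetic. -/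
theorem gl_vanishing_degrees (i : ℕ) (hi : i = 1 ∨ i = 2) :
    i < 4 ∧ i + 1 < 4 ∧ (i = 2 → ¬ i + 1 < 3) := by
  rcases hi with rfl | rfl <;> refine ⟨by norm_num, by norm_num, by omega⟩

end H2CarrierJunkXX

section H2ThetaSectionXXI

/-!
## [XXI] (report `H2-EXISTENCE-SIDE-21.md`, prover 3 gen 28): the THETA-SECTION CALCULUS for exotic hulls — THEOREM Y (resolution-free `v₁, v₂, v₃`
## of every reflexive rank-one hull via the smooth surface `Y = D ∩ Θ_b`), the Hodge-index JUNK BOUND `v₃(T) ≤ 3`, the configuration identity,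
## THEOREM M (two theta complete intersections on one member), and the SECANT habitat (members on Kummer secant lines)

THEOREM Y (report §2): for an integral member `D ∈ |2Θ|` with FINITE singular locus and a reflexive rank-one `𝓗` on `D`, the general theta translate
`Θ_b` cuts `D` in a smooth surface `Y` missing `Sing D` (Kleiman), with `h = θ|_Y`, `h² = 48`, `K_Y = 3h`, `c₂(Y) = 7h² = 336`, `χ(𝒪_Y) = (432 + 336)/12 = 64`
(also `= 0 − 1 − 16 + 81` by the Koszul complex), and `L := 𝓗|_Y` is a LINE BUNDLE; with `Q := c₁(L)·h`, `P := c₁(L)²`, Grothendieck–Riemann–Roch for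
`Y ↪ A` and `ch(i_*𝓗)·(1 − e^{−θ}) = ch(j_*L)` give in degrees 6 and 8: `12v₂ − 24 = Q − 72` and `4v₃ − 6v₂ + 8 = P/2 − 3Q/2 + 64`, i.e.
`12v₂ = Q − 48`, `4v₃ = P/2 − Q + 32` — [XVI] THEOREM A's formulas WITHOUT a small resolution and without rational singularities (`(Q, P) = (Q_W, P_W)`
when a small resolution exists). COROLLARY Y1 (§2.3): if `F ⊂ 𝓗` is H2-numerical (`Q = 72 + 48m`) then the junk class `v₃(T)γ` has `8v₃(T) = P − 16(3m² +
9m + 5)`, and the HODGE INDEX THEOREM on `Y` (`48P ≤ Q²`, the window `Q²/48 − 16(3m² + 9m + 5) = 28`) gives `0 ≤ v₃(T) ≤ 3`: the one-dimensional junk of ANY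
H2 object on such a member has class `0`, `2γ` or `3γ` (no `γ`-curve on `A`; `3γ` needs an irreducible ι-invariant curve of class `θ³/2`); the normalised class
`λ := c₁(L) − (m + 2)h` has `λ·h = −24`, `λ² = 8v₃(T) − 16 ∈ {−16, 0, 8}`. COROLLARY Y2/Y3 (§2.4–2.5): for `W = kΘ + Σ nᵢΣᵢ` (surfaces `Σᵢ ⊂ D ⊂ A`),
`P = 48k² + 48kN + Π` with `N := Σ nᵢsᵢ` (`[Σᵢ] = sᵢθ²`), `Π := Σ nᵢ²p(Σᵢ) + 2Σ_{i<j} nᵢnⱼc_{ij}`, `p(Σ) := K_Σ·θ − 2θ²·[Σ]` (the self-intersection of `Σ ∩ Θ_b` on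
`Y`, by the normal-bundle sequence — INDEPENDENT of `D`) and `c_{ij} = Σ_C (θ·C)·u_C` over the curves shared by `Σᵢ, Σⱼ` (also independent of `D`); the H2
condition reads `Π = 12N² − 28 + 8v₃(T)` (`8(3j² + 9j + 5) = 6N² − 14` for `N = 2j + 3`). THEOREM M (§3): two distinct theta complete intersections `Σ₁ = Θ_x ∩
Θ_y`, `Σ₂ = Θ_{x′} ∩ Θ_{y′}` on one member are either PARTNERS (`Σ₁ + Σ₂ = Θ_x|_D`, `c = 24`, one Weil class) or have `c(Σ₁, Σ₂) ≤ 20` (restricting `θ_{x′}, θ_{y′}`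
to `Σ₁`: `c = Σ d_C·min(μ_C, μ′_C) ≤ 24` with equality iff the two divisors coincide iff `P_{x′−y′}|_{Σ₁} ≅ 𝒪` iff `x′ = y′` — Koszul + Kodaira: `Pic⁰(A) ↪ Pic(Σ₁)`),
`4 ∣ c`; and then `nn′c = 6N² − 14 + 4v₃(T)` (`N = n + n′`) has NO solution with `nn′c ≠ 0` except the PURE cases `(c; n, n′) = (20; ±(1, 2))`, `(4; ±(2, −1))`,
which need a shared curve of θ-degree `≢ 0 (mod 8)` (class `γ`, `3γ` or `5γ`): the curve-sharing bitangent members `M_AP` of [XVI] §7 ([XX] 9.3's first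
candidates) carry NO H2-numerical exotic hull. PROPOSITION S (§4): the members of `|2Θ|` containing a theta c.i. `Θ_a ∩ Θ_c` (`a ≠ ±c`) form the Kummer SECANT
LINE `ℓ_{a,c}` (`h⁰(𝓘(2Θ)) = 1 + 1 − 0 + 0 = 2`); these members (`dim Sec = 2·4 + 1 = 9`; the tangent members `ℙ(Λ_a)` of [XVI] are their limits `c → a`) carry the
four planes `Θ_{±a} ∩ Θ_{±c}` through their 24 nodes `S_a ∩ S_c` and hulls `𝒪_D(Θ + Σ) ⊗ P` with the normal-form numerics `(0,2,2,2,2)`; by Krull the incidence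
`{(a, c, Z, D ∈ ℓ_{a,c}) : Z ⊂ D}` has all components of dimension `≥ 9 + d′ − h⁺ ≥ 4` (and [XVI] PROP B's `{(a, Z, D)}` of dimension `≥ 8 + d′ − h⁺ ≥ 3`: no
'pencil nests'), so the open part of the secant habitat is DEAD (`e₁^ι ≥ 4`); its special strata are a named residual (S-a…g). (0,1) NOT decided; no H2 object;
0 rungs.
-/

/-- THEOREM Y (report 2.1–2.2), the two Grothendieck–Riemann–Roch identities on the theta section `Y = D ∩ Θ_b` solved for `v₂, v₃`: from the degree-6
identity `12v₂ − 24 = Q − 72` (`θ²·ch₂ − θ³·ch₁/2 = h·(c₁(L) − K_Y/2)`, `K_Y = 3h`, `h² = 48`) and the degree-8 identity `4v₃ − 6v₂ + 8 = P/2 − 3Q/2 + χ(𝒪_Y)` with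
`χ(𝒪_Y) = 64`, one gets `12v₂ = Q − 48` and `4v₃ = P/2 − Q + 32` ([XVI] THEOREM A's formulas); the numerical inputs `K_Y² = 9·48 = 432`, `c₂(Y) = 7·48 = 336`,
`χ(𝒪_Y) = (432 + 336)/12 = 64 = 0 − 1 − 16 + 81` (Noether; Koszul with `χ(𝒪_A(−nΘ)) = n⁴`). Recorded: the linear algebra and the arithmetic. -/
theorem theta_section_v_vector (Q P v₂ v₃ : ℚ) (h6 : 12 * v₂ - 24 = Q - 72)
    (h8 : 4 * v₃ - 6 * v₂ + 8 = P / 2 - 3 * Q / 2 + 64) :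
    (12 * v₂ = Q - 48 ∧ 4 * v₃ = P / 2 - Q + 32) ∧
    ((9 : ℤ) * 48 = 432 ∧ (7 : ℤ) * 48 = 336 ∧ (432 + 336 : ℤ) / 12 = 64 ∧ (0 : ℤ) - 1 - 16 + 81 = 64) := by
  refine ⟨⟨by linarith, by linarith⟩, by norm_num⟩

/-- COROLLARY Y1 (report 2.3), the Hodge-index window: with `Q = 72 + 48m` (the `v₂`-condition) the Hodge index theorem `c₁(L)²·h² ≤ (c₁(L)·h)²` on `Y` reads
`48P ≤ Q² = 48·(48m² + 144m + 108)`, while the H2 target gives `8v₃(T) = P − 16(3m² + 9m + 5) = P − (48m² + 144m + 80)`; hence `8v₃(T) ≤ 28`, i.e. the junk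
class `v₃(T)γ` of EVERY H2 object supported on a member with finite singular locus has `v₃(T) ≤ 3`. The normalised class `λ = c₁(L) − (m + 2)h` has `λ·h = Q −
48(m + 2) = −24` and `λ² = P − 2(m + 2)Q + 48(m + 2)² = 8v₃(T) − 16`. Recorded: the inequality and the two identities. -/
theorem junk_bound_hodge_window (m P v : ℤ) (hH : 48 * P ≤ (72 + 48 * m) ^ 2)
    (hv : 8 * v = P - 16 * (3 * m ^ 2 + 9 * m + 5)) :
    v ≤ 3 ∧ (72 + 48 * m) - 48 * (m + 2) = -24 ∧
    P - 2 * (m + 2) * (72 + 48 * m) + 48 * (m + 2) ^ 2 = 8 * v - 16 := by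
  have hsq : (72 + 48 * m) ^ 2 = 48 * (48 * m ^ 2 + 144 * m + 108) := by ring
  refine ⟨?_, by ring, by rw [hv]; ring⟩
  have h1 : 384 * v ≤ 1344 := by nlinarith [hH, hsq, hv]
  omega

/-- COROLLARY Y3 (report 2.5), the configuration identity: writing the `v₂`-condition as `N = Σ nᵢsᵢ = 2j + 3` and `m = k + j`, the H2 target `P = 8v₃(T) + 16(3m² +
9m + 5)` minus the `k`-dependent part `48k² + 48kN` of `P = (kh + Σ nᵢσᵢ)²` leaves `Π = 12N² − 28 + 8v₃(T)` — independent of `k`; equivalently `8(3j² + 9j + 5) =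
6N² − 14`, and `3j² + 9j + 5` is always ODD. For ONE theta-type surface (`p = 0`, `s = 1`, `n = N`): `0 = 12N² − 28 + 8v` forces `(N², v) = (1, 2)` — [XVI] COR A2
(`N = ±1`, junk class `2γ`) recovered without a resolution. Recorded: the algebra. -/
theorem configuration_identity (k j v : ℤ) :
    (8 * v + 16 * (3 * (k + j) ^ 2 + 9 * (k + j) + 5)) - 48 * k ^ 2 - 48 * k * (2 * j + 3) = 12 * (2 * j + 3) ^ 2 - 28 + 8 * v ∧
    8 * (3 * j ^ 2 + 9 * j + 5) = 6 * (2 * j + 3) ^ 2 - 14 ∧ (3 * j ^ 2 + 9 * j + 5) % 2 = 1 ∧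
    (∀ N w : ℤ, (w = 0 ∨ w = 2 ∨ w = 3) → 0 = 12 * N ^ 2 - 28 + 8 * w → N ^ 2 = 1 ∧ w = 2) := by
  refine ⟨by ring, by ring, ?_, ?_⟩
  · rcases Int.even_or_odd' j with ⟨r, rfl | rfl⟩ <;> ring_nf <;> omega
  · intro N w hw h
    have h0 : 0 ≤ N ^ 2 := sq_nonneg N
    set X := N ^ 2 with hX
    omega

/-- THEOREM M (report §3), the Diophantine census of two NON-partner theta complete intersections `Σ₁, Σ₂` on one member with shared-curve weight `c = c(Σ₁, Σ₂) ∈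
{4, 8, 12, 16, 20}` (`c = 0`: no shared curve, the numerics see only `N = n + n′`; `c = 24` is excluded geometrically — it would force `x′ = y′`): the H2 condition
`nn′c = 6(n + n′)² − 14 + 4v₃(T)`, `v₃(T) ∈ {0, 2, 3}` (COR Y1; `v₃(T) = 1` is a `γ`-curve), has, for `nn′ ≠ 0`, ONLY the solutions `(c; n, n′; v₃(T)) = (20; ±(1,2);
0)` and `(4; ±(2,−1); 0)` — both PURE and both requiring a shared curve of θ-degree `≢ 0 (mod 8)`. Key inequality: `(n + n′)² = 4nn′ + (n − n′)² ≥ 4nn′`. In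
particular for `c ∈ {8, 12, 16}` (e.g. ONE shared Abel–Prym curve with multiplicity `u ≤ 2`, two Abel–Prym curves, or one shared curve of class
`4γ`) there is NO exotic solution: the curve-sharing bitangent members `M_AP` carry no H2-numerical exotic hull. Recorded: the complete enumeration. -/
theorem two_theta_ci_enumeration (n n' c v : ℤ) (hc : c = 4 ∨ c = 8 ∨ c = 12 ∨ c = 16 ∨ c = 20) (hv : v = 0 ∨ v = 2 ∨ v = 3)
    (hnn : n * n' ≠ 0) (h : n * n' * c = 6 * (n + n') ^ 2 - 14 + 4 * v) :
    (c = 20 ∧ v = 0 ∧ n * n' = 2 ∧ (n + n' = 3 ∨ n + n' = -3)) ∨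
    (c = 4 ∧ v = 0 ∧ n * n' = -2 ∧ (n + n' = 1 ∨ n + n' = -1)) := by
  -- the two facts about squares that the linear skeleton below forgets: 5 is not a square; t² = a² ⟹ t = ±a
  have nsq5 : ∀ t : ℤ, t ^ 2 ≠ 5 := fun t ht => by
    have h1 : -2 ≤ t := by nlinarith [sq_nonneg (t + 3)]
    have h2 : t ≤ 2 := by nlinarith [sq_nonneg (t - 3)]
    rcases (by omega : t = -2 ∨ t = -1 ∨ t = 0 ∨ t = 1 ∨ t = 2) with rfl | rfl | rfl | rfl | rfl <;> norm_num at ht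
  have sq : ∀ t a : ℤ, 0 ≤ a → t ^ 2 = a ^ 2 → t = a ∨ t = -a := fun t a _ h1 => by
    have h2 : (t - a) * (t + a) = 0 := by
      calc (t - a) * (t + a) = t ^ 2 - a ^ 2 := by ring
        _ = 0 := by rw [h1]; ring
    rcases mul_eq_zero.mp h2 with h3 | h3
    · left; linarith
    · right; linarith
  -- the linear skeleton: X = (n + n')² = 4Y + Z with Y = nn′ ≠ 0, Z = (n − n')² ≥ 0, and Y·c = 6X − 14 + 4v
  have e1 : (n + n') ^ 2 = 4 * (n * n') + (n - n') ^ 2 := by ring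
  have eZ : 0 ≤ (n - n') ^ 2 := sq_nonneg _
  have eX : 0 ≤ (n + n') ^ 2 := sq_nonneg _
  generalize hX : (n + n') ^ 2 = X at h e1 eX
  generalize hZ : (n - n') ^ 2 = Z at e1 eZ
  generalize hY : n * n' = Y at h e1 hnn
  rcases hc with rfl | rfl | rfl | rfl | rfl
  · -- c = 4: (X, Y, Z) = (1, −2, 9), v = 0
    have k : v = 0 ∧ X = 1 ∧ Y = -2 := by rcases hv with rfl | rfl | rfl <;> omega
    exact Or.inr ⟨rfl, k.1, k.2.2, sq _ 1 (by norm_num) (by rw [hX, k.2.1]; norm_num)⟩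
  · -- c = 8: forces Z = 5, not a square
    have k : Z = 5 := by rcases hv with rfl | rfl | rfl <;> omega
    exact absurd (hZ.trans k) (nsq5 _)
  · -- c = 12: no skeleton solution
    exfalso; rcases hv with rfl | rfl | rfl <;> omega
  · -- c = 16: forces X = 5, not a square
    have k : X = 5 := by rcases hv with rfl | rfl | rfl <;> omega
    exact absurd (hX.trans k) (nsq5 _)
  · -- c = 20: (X, Y, Z) = (9, 2, 1), v = 0
    have k : v = 0 ∧ X = 9 ∧ Y = 2 := by rcases hv with rfl | rfl | rfl <;> omega
    exact Or.inl ⟨rfl, k.1, k.2.2, sq _ 3 (by norm_num) (by rw [hX, k.2.1]; norm_num)⟩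

/-- COROLLARY Y4 (report 2.6), single surfaces: a surface `Σ ⊂ D` of class `sθ²` entering the hull with multiplicity `n` (so `N = ns` odd) needs `n²p(Σ) = 12N² −
28 + 8v₃(T)`; for `(s, n) = (1, 1)`: `p(Σ) = −16, 0, 8` resp. `K_Σ·θ = p + 48 = 32, 48, 56` for `v₃(T) = 0, 2, 3` (theta c.i., polar surfaces, theta-intersections:
`K_Σ·θ = 48`, `p = 0`, the middle case); the complete intersections `Θ_x ∩ |sΘ|` have `K = (1 + s)θ`, `p = 24s(s + 1) − 48s = 24s(s − 1) ≡ 0 (mod 48)` and are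
H2-sterile as single exotic surfaces for `s ≥ 3` (`p = 144, 480, …` against the targets `80/96/104`, `272/288/296`, …). Recorded: the arithmetic. -/
theorem single_surface_p_table (s : ℤ) :
    (12 * (1 : ℤ) ^ 2 - 28 + 8 * 0 = -16 ∧ 12 * (1 : ℤ) ^ 2 - 28 + 8 * 2 = 0 ∧ 12 * (1 : ℤ) ^ 2 - 28 + 8 * 3 = 8) ∧
    (24 * s * (s + 1) - 48 * s = 24 * (s * (s - 1))) ∧ (48 ∣ 24 * (s * (s + 1))) ∧
    ((12 : ℤ) * 3 ^ 2 - 28 = 80 ∧ (24 : ℤ) * 3 * 2 = 144 ∧ (12 : ℤ) * 5 ^ 2 - 28 = 272 ∧ (24 : ℤ) * 5 * 4 = 480) := by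
  refine ⟨by norm_num, by ring, ?_, by norm_num⟩
  obtain ⟨r, hr⟩ := Int.even_mul_succ_self s
  exact ⟨r, by rw [hr]; ring⟩

/-- PROPOSITION S (report §4), the secant habitat's bookkeeping: the members of `|2Θ|` through `Θ_a ∩ Θ_c` (`a ≠ ±c`) are a PENCIL (Koszul: `h⁰ = h⁰(Θ_{−a}) +
h⁰(Θ_{−c}) − 0 + 0 = 2`; for `c = −a` the count is `1 + 1 − 1 + 4 = 5`, [XVI] 1.1), the secant variety of the Kummer fourfold has dimension `2·4 + 1 = 9 = 8 + 1`
(the tangent members form its boundary of dimension `8`), a theta c.i. lies on exactly `[y = x] + [y = x′]` theta translates, and Krull's bound for the incidence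
'`Z ⊂ D`' cut by `h⁺ ≤ 5` equations: secant `9 + d′ − h⁺ ≥ 4 + d′ ≥ 4`, tangent `8 + d′ − h⁺ ≥ 3 + d′ ≥ 3` (so [XVI] PROP B's exceptional 'pencil nest' components
of dimension `1` cannot occur); by the family mechanism the open part of the secant habitat has `e₁^ι ≥ 4 > 1`. Recorded: the arithmetic. -/
theorem secant_habitat_counts (d h : ℕ) (hh : h ≤ 5) :
    (1 : ℕ) + 1 - 0 + 0 = 2 ∧ (2 : ℕ) * 4 + 1 = 9 ∧ 9 = 8 + 1 ∧
    4 + d ≤ 9 + d - h ∧ 3 + d ≤ 8 + d - h ∧ (1 : ℕ) < 4 := by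
  refine ⟨by norm_num, by norm_num, by norm_num, by omega, by omega, by norm_num⟩

end H2ThetaSectionXXI

section H2PointSharingXXIA

/-!
## [XXI] ADDENDUM A (report §7): THEOREM N — two distinct theta complete intersections on an IRREDUCIBLE member of |2Θ| always share a
## CURVE (except the ι-conjugate pair {Σ, ιΣ} of equal class on a secant member); the cell (d-θ-pt) is VOID and N16-M′ holds in the
## form 'every bitangent pair shares a curve'

THEOREM N (report 7.1). Tangent case: an irreducible member `D ∈ ℙ(Λ_a)` is `{λθ_aθ_{−a} + W_v = 0}` with `v ≠ 0`, and on `Θ_a` its equation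
restricts to `∂_vθ_a·θ_{−a}` ([XVI] 1.6); if `D ⊃ Σ₂ = Θ_{x′} ∩ Θ_{y′}` with `a ∉ {x′, y′}`, this product vanishes on the complete-intersection curve
`C = Θ_a ∩ Σ₂`; if `S_a ∩ Σ₂` contains no curve, `θ_{−a}` is a non-zero-divisor on `𝒪_C` (Cohen–Macaulay, no component in `Θ_{−a}`), so `∂_vθ_a|_C =
0`; but `H⁰(Θ_a, 𝓘_C(Θ_a)) = 0` — Koszul on `Θ_a`: the two middle terms are non-trivial points of `Pic⁰` restricted to `Θ_a` (`h⁰ = 0` by Kodaira on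
`A`), the left term is `𝒪_{Θ_a}(−Θ_w)` (`h¹ = 0` by Kodaira in degrees `1, 2 < 4`) — so `∂_vθ_a|_{Θ_a} = 0`, i.e. `v` is everywhere tangent to `Θ_a`,
impossible for `v ≠ 0` (finite stabiliser of a principal polarisation): CONTRADICTION. Secant case: `D_t ⊃ Σ′ = Θ_{x′} ∩ Θ_{y′}` with `{x′, y′} ∩
{±a, ±c} = ∅` gives on the normal surface `Σ′` the equality of effective divisors `E_a + E_{−a} = E_c + E_{−c}` (all of θ-degree `24`); if `E_a` and
`E_c` had no common component then `E_a ≤ E_{−c}`, and equal degrees force `E_a = E_{−c}`, i.e. `P_{a+c}|_{Σ′} ≅ 𝒪`, i.e. `a = −c` — CONTRADICTION; so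
`Σ′` shares a curve with each of the four planes `Θ_{±a} ∩ Θ_{±c}`. COROLLARY: with THEOREM M, every two-class theta-generated hull on any irreducible
member with finite singular locus is H2-sterile [mod (odd)]; the cell (d-θ-pt) of [XXI] §5 is VOID; [XVI]'s conjecture N16-M′ holds as 'M ⊆ {curve-
sharing pairs}'. (0,1) NOT decided; no H2 object; 0 rungs.
-/

/-- THEOREM N, tangent case (report 7.1 (I)), the cohomological bookkeeping of `H⁰(Θ_a, 𝓘_C(Θ_a)) = 0` for `C = Θ_a ∩ Θ_{x′} ∩ Θ_{y′}`, `a ∉ {x′, y′}`: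
from the Koszul sequence on `Θ_a` twisted by `Θ_a`, `h⁰(𝓘_C(Θ_a)) ≤ h⁰(𝒪_{Θ_a}(Θ_a − Θ_{x′})) + h⁰(𝒪_{Θ_a}(Θ_a − Θ_{y′})) + h¹(𝒪_{Θ_a}(Θ_a − Θ_{x′} − Θ_{y′}))`,
and each term is `0`: the first two are restrictions to `Θ_a` of NON-trivial points `P` of `Pic⁰(A)` (`h⁰(P|_{Θ_a}) ≤ h⁰(A, P) + h¹(A, P(−Θ_a)) = 0 + 0`),
the third is `𝒪_{Θ_a}(−Θ_w)` (`h¹ ≤ h¹(A, 𝒪(−Θ_w)) + h²(A, 𝒪(−Θ_w − Θ_a)) = 0 + 0`, Kodaira in degrees `1, 2 < 4 = dim A`); and `dim H⁰(Θ_a, 𝒪_{Θ_a}(Θ_a)) =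
h⁰(𝒪_A(Θ_a)) − h⁰(𝒪_A) + h¹(𝒪_A) = 1 − 1 + 4 = 4 = dim T₀A` (the sections `∂_vθ_a|`). Recorded: the arithmetic and the degree conditions. -/
theorem theta_restriction_vanishing :
    (0 : ℕ) + 0 + (0 + 0) = 0 ∧ (0 : ℕ) + 0 = 0 ∧ (1 < 4 ∧ 2 < 4) ∧ (1 : ℤ) - 1 + 4 = 4 := by
  refine ⟨by norm_num, by norm_num, ⟨by norm_num, by norm_num⟩, by norm_num⟩

/-- THEOREM N, secant case (report 7.1 (II)), the divisor squeeze: on the normal surface `Σ′` the equation of `D_t` gives `E_a + E_{−a} = E_c + E_{−c}`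
(effective divisors, each of θ-degree `θ²·θ² = 24`); if `E_a` and `E_c` share no component then `E_a ≤ E_{−c}`, so `E_{−c} = E_a + R` with `R ≥ 0` of
θ-degree `24 − 24 = 0`, hence `R = 0` (θ is ample: a non-zero effective divisor has positive degree) and `E_a = E_{−c}`, i.e. `𝒪_{Σ′}(Θ_a) ≅ 𝒪_{Σ′}(Θ_{−c})`,
i.e. `a = −c` by `Pic⁰(A) ↪ Pic(Σ′)` — excluded. The same with `(a, −c)` replaced by `(a, c)`, `(−a, ±c)`: `Σ′` shares a curve with each of the four
planes. Recorded: the degree bookkeeping (`deg R = 0 ⟹ R = 0` as 'a sum of positive weights times multiplicities vanishes only if all multiplicities do',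
in its two-component instance, and the four degrees). -/
theorem effective_divisor_squeeze (w₁ w₂ m₁ m₂ d : ℕ) (hw₁ : 0 < w₁) (hw₂ : 0 < w₂)
    (hdeg : 24 + d = 24) (hR : d = w₁ * m₁ + w₂ * m₂) :
    d = 0 ∧ m₁ = 0 ∧ m₂ = 0 ∧ (24 : ℕ) = 24 ∧ (24 : ℕ) + 24 = 24 + 24 := by
  have hd : d = 0 := by omega
  subst hd
  have h1 : w₁ * m₁ = 0 := by omega
  have h2 : w₂ * m₂ = 0 := by omega
  refine ⟨rfl, ?_, ?_, rfl, rfl⟩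
  · rcases Nat.mul_eq_zero.mp h1 with h | h <;> omega
  · rcases Nat.mul_eq_zero.mp h2 with h | h <;> omega

end H2PointSharingXXIA

end Summit.HodgeConjecture.HodgeConjecture.WeilTypeLadder
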